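import Summits.BirchSwinnertonDyer.BirchSwinnertonDyer.Theorems.PrintCf2SplitBadTwoRestrictedSelmerTopOfConjFiniteness
import Summits.BirchSwinnertonDyer.Rank1Residual.X11b.AnticyclotomicLocalTorsionDescent
import HarnessLib

/-!
# Crux `PrintCf2.SplitBadTwoRankOneOfFacts` (stmt-BirchSwinnertonDyer-20368), road α v10.3 — S3c residual (R-TOP) = brick B17:
# the local torsion bound «`2^m · E[2^∞]^{Γ_{K_v}} = 0`» (hfix of p673077) DISCHARGED on every S3c frame, and (R-TOP) re-assembled without it

Cell `bsd-print-cf2`, EXTRA WIDTH seat `bsd-line-cf2-p1-w4` g9 (prover-bsd-line-cf2-p1-w4-g9-0); `--supports stmt-BirchSwinnertonDyer-20368`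
(helper, Theses-free). HONEST FRAMING: nothing here closes the crux or a registered stub; BSD is not proved by any of this; no summit statement
is proved by this seat. No definition, no named fact, no `sorry`.

WHAT. `pow_smul_eq_zero_of_fixed_decomp` (generic, elliptic `V` over a number field `K`, prime `p`, place `𝔭`): a uniform `p`-power exponent for the
points of the completion `E(K_𝔭)` (X11b `exists_pow_nsmul_local_eq_zero` supplies one on the frame) kills every `D_𝔭`-fixed point of `E(K̄)[p^∞]` —
X11b's `eq_zero_of_fixed_decomp_of_local` (descent along the chosen embedding `K̄ → K̄_𝔭`, `exists_map_eq_of_forall_smul_localPoints_eq`,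
injectivity of `E(K_𝔭) → E(K̄_𝔭)` and of `pointsMapOfEmb`) with «`E(K_𝔭)[p] = 0`» replaced by the exponent. `exists_pow_smul_eq_zero_of_fixed_of_frame`:
hfix on the S3c frame (`2` splits in `K = ℚ(√−7)`). **`natCard_endCoinvariants_eq_one_of_frame_of_conjFiniteness'`**: p673077 with hfix discharged —
(R-TOP) of p664178 ⟸ `[W.IsGloballyMinimal]` + the three cited facts + hfinB′ + hfinR′ (both about the CONJUGATE summand `W*′`).
presearch: Silverman AEC VII.3 / VIII.1 (local torsion finite); no new fact. beyond-print theorem: no.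

References: [SilvermanAEC2009] VII.§3, VIII.§1; [JetchevSkinnerWan2017] Lemma 3.3.3; [GreenbergLNM1716] §4.
-/

noncomputable section

open scoped Classical

set_option linter.dupNamespace false
set_option autoImplicit false

open CategoryTheory NumberField IsDedekindDomain Field WeierstrassCurve
open Literature.NumberTheory.EllipticCurves Literature.NumberTheory.EllipticCurves.GreenbergSelmer
open Literature.NumberTheory.EllipticCurves.Agboola2007
open Literature.NumberTheory.EllipticCurves.IwasawaAlgebra
open Literature.NumberTheory.EllipticCurves.IwasawaDual
open Literature.NumberTheory.GaloisRepresentations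
open Literature.NumberTheory.GaloisCohomology
open scoped ContRepresentation
open Summit.BirchSwinnertonDyer.Rank1Residual.X11b
open Summit.BirchSwinnertonDyer.Rank1Residual.X11b.LocBridge
open Summit.BirchSwinnertonDyer.Rank1Residual.X11b.AcSelmer
open Summit.BirchSwinnertonDyer.BirchSwinnertonDyer.Theorems.PrintCf2.AdditiveAtSeven
open Summit.BirchSwinnertonDyer.BirchSwinnertonDyer.Theorems.PrintCf2.ReductionTypesOverK

universe u

namespace Summit.BirchSwinnertonDyer.BirchSwinnertonDyer.Theorems.PrintCf2.RestrictedSelmerPair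

/-! ## §1. Generic: a local `p`-power exponent kills the `D_𝔭`-fixed geometric `p`-primary points -/

section Generic

variable {K : Type u} [Field K] [NumberField K] (W : WeierstrassCurve K) (p : ℕ)

/-- **`p^e · E(K̄)[p^∞]^{D_𝔭} = 0` if `p^e` kills every `p`-power torsion point of `E(K_𝔭)`**: a `D_𝔭`-fixed point `m` maps along the chosen
embedding `K̄ → K̄_𝔭` to a `Γ_{K_𝔭}`-fixed point, which descends to `R ∈ E(K_𝔭)`; `R` is `p`-power torsion with `m`, so `p^e R = 0`, so `p^e m = 0`
(injectivity of `E(K_𝔭) → E(K̄_𝔭)` and of the embedding on points). [cite: SilvermanAEC2009, VIII.§1 (proof of Prop. 1.2) and VII.§3] -/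
theorem pow_smul_eq_zero_of_fixed_decomp (𝔭 : HeightOneSpectrum (𝓞 K)) {e : ℕ}
    (htor : ∀ (j : ℕ) (R : (W.baseChange (𝔭.adicCompletion K)).toAffine.Point), p ^ j • R = 0 → p ^ e • R = 0)
    (m : W.geomPrimaryTorsion p) (hfix : ∀ d ∈ decomp 𝔭, d • m = m) : p ^ e • m = 0 := by
  set ι₀ := closureEmb (K := K) (𝔭.adicCompletion K) with hι₀
  set X : localPoints W (𝔭.adicCompletion K) := pointsMapOfEmb W ι₀ (m : W.geomPoints) with hX
  have hXfix : ∀ τ : absoluteGaloisGroup (𝔭.adicCompletion K), τ • X = X := fun τ ↦ by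
    have hmem : resGalOfEmb ι₀ τ ∈ decomp 𝔭 := (mem_decomp_iff 𝔭 _).mpr ⟨τ, rfl⟩
    have h : resGalOfEmb ι₀ τ • (m : W.geomPoints) = m :=
      congrArg (fun x : W.geomPrimaryTorsion p ↦ (x : W.geomPoints)) (hfix _ hmem)
    rw [hX, ← pointsMapOfEmb_smul, h]
  haveI : CharZero (𝔭.adicCompletion K) :=
    charZero_of_injective_algebraMap (algebraMap K (𝔭.adicCompletion K)).injective
  obtain ⟨R, hR⟩ := exists_map_eq_of_forall_smul_localPoints_eq W (𝔭.adicCompletion K) hXfix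
  have hinj := WeierstrassCurve.Affine.Point.map_injective (W' := W)
    (IsScalarTower.toAlgHom K (𝔭.adicCompletion K) (AlgebraicClosure (𝔭.adicCompletion K)))
  -- `m` is `p`-power torsion, hence so are `X` and `R`
  obtain ⟨k, hk⟩ := (AddCommGroup.mem_primaryComponent).mp m.2
  have hkX : p ^ k • X = 0 := by
    rw [hX, ← (pointsMapOfEmb W ι₀).map_nsmul, hk, (pointsMapOfEmb W ι₀).map_zero]
  have hkR : p ^ k • R = 0 := by
    apply hinj
    rw [map_nsmul, hR, map_zero]
    exact hkX
  have heR : p ^ e • R = 0 := htor k R hkR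
  have heX : p ^ e • X = 0 := by
    have h1 : (WeierstrassCurve.Affine.Point.map
        (IsScalarTower.toAlgHom K (𝔭.adicCompletion K) (AlgebraicClosure (𝔭.adicCompletion K)))) (p ^ e • R) = p ^ e • X := by
      rw [map_nsmul, hR]
      rfl
    rw [← h1, heR, map_zero]
    rfl
  have hem : ((p ^ e • m : W.geomPrimaryTorsion p) : W.geomPoints) = 0 :=
    pointsMapOfEmb_injective W ι₀ (by
      rw [(pointsMapOfEmb W ι₀).map_zero, AddSubgroupClass.coe_nsmul, (pointsMapOfEmb W ι₀).map_nsmul, ← hX]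
      exact heX)
  exact Subtype.ext (by rw [hem]; rfl)

/-- The same in the `restrictField` currency of the Galois-representation library (`Γ_{K_𝔭}` acting through `absGaloisRestrict`, whose image is
`D_𝔭`, `mem_decomp_iff`). [cite: SilvermanAEC2009, VIII.§1] -/
theorem pow_smul_eq_zero_of_fixed_restrictField (𝔭 : HeightOneSpectrum (𝓞 K)) {e : ℕ}
    (htor : ∀ (j : ℕ) (R : (W.baseChange (𝔭.adicCompletion K)).toAffine.Point), p ^ j • R = 0 → p ^ e • R = 0)
    (Q : W.geomPrimaryTorsion p)
    (hQ : ∀ σ : absoluteGaloisGroup (𝔭.adicCompletion K), GaloisRep.restrictField (𝔭.adicCompletion K) (primaryGaloisModule W p) σ Q = Q) :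
    p ^ e • Q = 0 := by
  refine pow_smul_eq_zero_of_fixed_decomp W p 𝔭 htor Q fun d hd ↦ ?_
  obtain ⟨σ, hσ⟩ := (mem_decomp_iff 𝔭 _).mp hd
  have h1 : absGaloisRestrict K (𝔭.adicCompletion K) σ • Q = Q := hQ σ
  rw [hσ] at h1
  exact h1

end Generic

/-! ## §2. Road α: hfix on the S3c frame, and (R-TOP) without it -/

section Frame

variable {K : Type} [Field K] [NumberField K]

/-- **hfix on every S3c frame**: some `2^m` kills `E[2^∞]^{Γ_{K_v}}` (`2` splits in `K = ℚ(√−7)`; X11b's uniform local exponent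
`exists_pow_nsmul_local_eq_zero`, carrying `[W.IsGloballyMinimal]`). [cite: SilvermanAEC2009, VII.§3 and VIII.§1] -/
theorem exists_pow_smul_eq_zero_of_fixed_of_frame {d : ℤ} (hd0 : d ≠ 0) (W : WeierstrassCurve ℚ) [W.IsElliptic] [W.IsGloballyMinimal]
    (C : VariableChange ℚ) (hC : C • W = cm7.quadraticTwist (d : ℚ)) (hK : IsImaginaryQuadratic K) (v : HeightOneSpectrum (𝓞 K))
    (π : (W.baseChange K).endRing) (hrel : (π : AddMonoid.End (W.baseChange K).geomPoints) * π = π - 2) :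
    ∃ m : ℕ, ∀ Q : (W.baseChange K).geomPrimaryTorsion 2,
      (∀ σ : absoluteGaloisGroup (v.adicCompletion K),
        GaloisRep.restrictField (v.adicCompletion K) (primaryGaloisModule (W.baseChange K) 2) σ Q = Q) → 2 ^ m • Q = 0 := by
  haveI : Fact (Nat.Prime 2) := ⟨Nat.prime_two⟩
  haveI : (W.baseChange K).IsElliptic := by rw [baseChange]; infer_instance
  have hj : W.j = -3375 := j_eq_of_smul_eq_cm7Twist hd0 W C hC
  obtain ⟨θ, hθ⟩ := exists_sq_eq_neg_seven_of_cmEndo_mem_endRing W K hj π hrel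
  have hdK := discr_eq_neg_seven_of_sq_eq K hK hθ hd0 W hC
  have hs : SplitsIn K 2 := by
    unfold SplitsIn
    rw [Nat.cast_ofNat, Literature.NumberTheory.QuadraticFields.Quadratic.ncard_primesOver_two_eq_two_iff hK.1, hdK]
    decide
  obtain ⟨m, hm⟩ := exists_pow_nsmul_local_eq_zero W 2 hK.1 hs v
  exact ⟨m, fun Q hQ ↦ pow_smul_eq_zero_of_fixed_restrictField (W.baseChange K) 2 v hm Q hQ⟩

/-- **(R-TOP) of `restrictedControl_two_of_residuals` (p664178) with the local torsion bound discharged**: on every S3c frame with a finitely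
generated dual datum and `HasCharValuationAt n`, `#𝔖_Γ = 1` — GRANTED `[W.IsGloballyMinimal]`, the three cited facts `poitouTate_sha_tateDual K`,
`poitouTate_selmerStructure_duality K`, `fieldCdLE_two_of_numberField`, and the two CONJUGATE-SUMMAND finiteness inputs hfinB′ (`𝔖_v(K, W*′)` finite)
and hfinR′ (the `E[𝔮̄^∞]`-parts of Castella's relaxed conjugate groups finite). [cite: Agboola2007, §5 Prop. 5.1]
[cite: JetchevSkinnerWan2017, Lemma 3.3.3 and Prop. 3.3.2] [cite: GreenbergLNM1716, §4 Props. 4.13–4.15] -/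
theorem natCard_endCoinvariants_eq_one_of_frame_of_conjFiniteness' {d : ℤ} (hd0 : d ≠ 0) (W : WeierstrassCurve ℚ) [W.IsElliptic]
    [W.IsGloballyMinimal] (C : VariableChange ℚ) (hC : C • W = cm7.quadraticTwist (d : ℚ)) (hK : IsImaginaryQuadratic K)
    (v vbar : HeightOneSpectrum (𝓞 K)) (hv : ((2 : ℕ) : 𝓞 K) ∈ v.asIdeal) (hvbar : ((2 : ℕ) : 𝓞 K) ∈ vbar.asIdeal) (hne : vbar ≠ v)
    (π : (W.baseChange K).endRing) (hrel : (π : AddMonoid.End (W.baseChange K).geomPoints) * π = π - 2) {r : ℤ_[2]} (hr : r * r = r - 2)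
    (κ' : ZpExtension K 2) (hκ' : κ'.IsUnramifiedOutside vbar) {γ' : absoluteGaloisGroup K} (hγ' : κ'.IsTopGenerator γ')
    (D : RestrictedDualData κ' ↥((W.baseChange K).endEigenPrimaryTorsion 2 π r) vbar γ') {n : ℕ}
    (hDf : Module.Finite (IwasawaAlgebra 2) D.X) (hDn : D.HasCharValuationAt n)
    (hPT : poitouTate_sha_tateDual K) (hPTs : poitouTate_selmerStructure_duality K) (hcd : fieldCdLE_two_of_numberField)
    (hfin' : Finite (restrictedSelmerBase ↥((W.baseChange K).endEigenPrimaryTorsion 2 π (1 - r)) 2 v))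
    (hfinR' : ∀ (e' : (W.baseChange K).geomPrimaryTorsion 2 →+ ↥((W.baseChange K).endEigenPrimaryTorsion 2 π (1 - r)))
      (j' : (primaryGaloisModule (W.baseChange K) 2).toContRepresentation →ⁱL (primaryGaloisModule (W.baseChange K) 2).toContRepresentation),
      (∀ x, j' x = (e' x : (W.baseChange K).geomPrimaryTorsion 2)) →
      ∀ R : Set (HeightOneSpectrum (𝓞 K)), R.Finite → (∀ w ∈ R, ((2 : ℕ) : 𝓞 K) ∉ w.asIdeal) →
        Finite (((acStructure (primaryGaloisModule (W.baseChange K) 2) 2 v R).selmerGroup).map (galoisCohomology.map j' 1))) :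
    Nat.card (EndCoinvariants
      (conjRestricted κ' ↥((W.baseChange K).endEigenPrimaryTorsion 2 π r) vbar γ' - 1)) = 1 :=
  natCard_endCoinvariants_eq_one_of_frame_of_conjFiniteness hd0 W C hC hK v vbar hv hvbar hne π hrel hr κ' hκ' hγ' D hDf hDn hPT hPTs hcd
    hfin' hfinR' (exists_pow_smul_eq_zero_of_fixed_of_frame hd0 W C hC hK v π hrel)

end Frame

end Summit.BirchSwinnertonDyer.BirchSwinnertonDyer.Theorems.PrintCf2.RestrictedSelmerPair

end
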